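import Mathlib
import HarnessLib
import Summits.FinalStateConjecture.Statement
import Literature.Geometry.Lorentzian.LandauLifshitzPseudotensor

/-!
# Route EIHFluxBalance — `InertialRecession`, line `sublinear-is-free-clean-window-charges`:
# real-variable bookkeeping of the window law (helpers for `stub_chargeModel`)

Helper file (`--supports stmt-FinalStateConjecture-10166`) for the crux
`Summit.FinalStateConjecture.FinalStateConjecture.Theses.EIHFluxBalance.InertialRecession`:
the flux integrand `r² (K r^{-7/4})² = K² r^{-3/2}` of the moving-sphere law with the sphere bound
`b = K r^{-7/4}`, and the cost `2^{3/2}` of halving the radius in `r^{-3/2}`; used by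
`…StubChargeModelWindowLaw`.
-/

set_option linter.dupNamespace false

noncomputable section

namespace Summit.FinalStateConjecture.FinalStateConjecture.Theorems

namespace SublinearIsFree.ChargeModel

/-- **The flux integrand of the window law**: with the sphere bound `b = K r^{-7/4}` the integrand
`r² b²` of the moving-sphere law is `K² r^{-3/2}` (`r > 0`). [folklore] -/
theorem windowIntegrand_eq (K r : ℝ) (hr : 0 < r) :
    r ^ 2 * (K * (r ^ (7 / 4 : ℝ))⁻¹) ^ 2 = K ^ 2 * (r ^ (3 / 2 : ℝ))⁻¹ := by
  have hA : (r ^ (7 / 4 : ℝ)) ^ 2 = r ^ (7 / 2 : ℝ) := by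
    rw [sq, ← Real.rpow_add hr]; norm_num
  have hB : r ^ 2 * r ^ (3 / 2 : ℝ) = r ^ (7 / 2 : ℝ) := by
    rw [← Real.rpow_two, ← Real.rpow_add hr]; norm_num
  calc r ^ 2 * (K * (r ^ (7 / 4 : ℝ))⁻¹) ^ 2 = K ^ 2 * (r ^ 2 * ((r ^ (7 / 4 : ℝ)) ^ 2)⁻¹) := by ring
    _ = K ^ 2 * (r ^ 2 * (r ^ 2 * r ^ (3 / 2 : ℝ))⁻¹) := by rw [hA, ← hB]
    _ = K ^ 2 * (r ^ (3 / 2 : ℝ))⁻¹ := by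
        congr 1
        rw [mul_inv, ← mul_assoc, mul_inv_cancel₀ (pow_ne_zero 2 hr.ne'), one_mul]

/-- Halving the radius costs a factor `2^{3/2}` in `r^{-3/2}`: for `0 < r'` and `r'/2 ≤ r`,
`r^{-3/2} ≤ 2^{3/2} r'^{-3/2}`. [folklore] -/
theorem rpow_threeHalves_inv_le (r r' : ℝ) (hr' : 0 < r') (hle : r' / 2 ≤ r) :
    (r ^ (3 / 2 : ℝ))⁻¹ ≤ (2 : ℝ) ^ (3 / 2 : ℝ) * (r' ^ (3 / 2 : ℝ))⁻¹ := by
  have h1 : (r' / 2) ^ (3 / 2 : ℝ) ≤ r ^ (3 / 2 : ℝ) := Real.rpow_le_rpow (by positivity) hle (by norm_num)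
  have h2 : (r' / 2) ^ (3 / 2 : ℝ) = r' ^ (3 / 2 : ℝ) / (2 : ℝ) ^ (3 / 2 : ℝ) :=
    Real.div_rpow hr'.le (by norm_num) _
  have h3 : 0 < (r' / 2) ^ (3 / 2 : ℝ) := Real.rpow_pos_of_pos (by positivity) _
  calc (r ^ (3 / 2 : ℝ))⁻¹ ≤ ((r' / 2) ^ (3 / 2 : ℝ))⁻¹ := inv_anti₀ h3 h1
    _ = (2 : ℝ) ^ (3 / 2 : ℝ) * (r' ^ (3 / 2 : ℝ))⁻¹ := by rw [h2, inv_div, div_eq_mul_inv]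

end SublinearIsFree.ChargeModel

/-- Registered sub-goal form (stub `stub_chargeModel_windowIntegrand` of the crux item) of
`SublinearIsFree.ChargeModel.windowIntegrand_eq` (bookkeeping for `…StubChargeModelWindowLaw`). [folklore] -/
theorem stub_chargeModel_windowIntegrand : ∀ (K r : ℝ), 0 < r → r ^ 2 * (K * (r ^ (7 / 4 : ℝ))⁻¹) ^ 2 = K ^ 2 * (r ^ (3 / 2 : ℝ))⁻¹ :=
  SublinearIsFree.ChargeModel.windowIntegrand_eq

end Summit.FinalStateConjecture.FinalStateConjecture.Theorems

end
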